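import Summits.CriticalPhenomena.PercolationContinuityZ3.Theorems.Transplant.SkelPhiNegReachFloorsK
import HarnessLib

/-!
# N1 (the `{±1}` node), (C) column under (ζ′) — file (C-S10b-K): THE BAND AND TARGET FLOORS WITH THE BOX MULTIPLIER `kq` (the twin of §3–§4 of
# `SkelPhiNegReachFloors` (C-S10, p302688); NEG-SCOPE §B.19 (ζ′): one cell = `20·r = 800·kq` strides, `40kq ≤ r_i`): from (P1) `2000·(T + 2) ≤ n`,
# (P2) `2000·(T + 2)·U ≤ nℓ − n`, (P3-K) `W_A ≤ 24kq·n`, (P4-K) `U·(L0_A + 1) ≤ 12kq·Δ`, (P5) `r_i ≤ 4·b₀_i` (RULING B.16), with `|v| ≤ n`,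
# `nℓ − n < Δ ≤ nℓ`: §3 **`floors_bandK`** (`hbx1–3`, `hby1–3` of `CorrRec.hrdC1K / hrdZCK` in the (ζ′) scale); §4 **`floors_targetK`** (`hxL1`,
# `hxL3`, `hyL1–3` of `CorrRec.hrdLCK`). The case `kq = 1` is the record (C-S10).

builds on p205010 (kernel theorem, internal audit signed; external expert review pending) — nothing in this file uses p205010; nothing here is a
claim about the open node `SamePDropOfSkeletonNeg₁`.
Lane `prim-bschramm`, seat `prim-bschramm-p5` (gen 11; (C) lineage); helper file (`--supports stmt-CriticalPhenomena-4575`).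
[cite: KozmaNitzan2024, §4 Lemma 11 (p. 22), Lemma 12 (pp. 23–25), p. 26 (M_v)] [cite: MartineauTassion2017, §4.3 Lemma 4.2]
-/

noncomputable section

namespace Summit.CriticalPhenomena.PercolationContinuityZ3.Theorems

namespace Transplant

namespace Skelφ

namespace CorrRec

open Literature.Probability.Percolation Literature.Probability.LatticeModels
open Literature.Probability.Percolation.KozmaNitzan.Cells (oth oth_ne sgOf sgOf_sign eq_oth_of_ne)
open TwoAxis.Para (modulus)
open ChainPlanar ChainPara

section BandK

variable {kq n ℓ T : ℕ} {h v vβ aW bL : ℤ}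
  (hkq : 1 ≤ kq) (hn : 1 ≤ n) (hvn : |v| ≤ n) (hΔlo : (n : ℤ) * ℓ - n < modulus n h v vβ) (hΔhi : modulus n h v vβ ≤ (n : ℤ) * ℓ)
  (P1 : 2000 * (T + 2) ≤ n) (P2 : 2000 * ((T : ℤ) + 2) * (shearUnit n h : ℤ) ≤ (n : ℤ) * ℓ - n)

/-! ## §3 The floors of the band -/

include hkq hn hvn hΔlo hΔhi P1 P2 in
/-- **The band floors `hbx1–3`, `hby1–3` in the (ζ′) scale** from (P1)–(P4-K) and `40kq ≤ r₀`.
[cite: KozmaNitzan2024, §4 Lemma 11 (p. 22), Lemma 12 (pp. 23–25)] -/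
theorem floors_bandK {P : PCells2} (hr40 : ∀ i, 40 * (kq : ℤ) ≤ (P.r i : ℤ)) (P3 : ((WA n aW : ℕ) : ℤ) ≤ 24 * (kq : ℤ) * n)
    (P4 : (shearUnit n h : ℤ) * (((L0A bL : ℕ) : ℤ) + 1) ≤ 12 * (kq : ℤ) * modulus n h v vβ) :
    (modulus n h v vβ * (2 * n + 800 * (kq : ℤ) * T) + |v| * ((shearUnit n h : ℤ) * ((qy n ℓ h v T aW bL : ℕ) + 800 * (kq : ℤ) * T + (3 * (n * ℓ) / shearUnit n h + 1 : ℕ) + 1))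
      + 3 * modulus n h v vβ * n ≤ 40 * (kq : ℤ) * 5 * modulus n h v vβ * n) ∧
    (modulus n h v vβ * ((800 * (kq : ℤ) + 1) * n + 800 * (kq : ℤ) * T) + |v| * ((shearUnit n h : ℤ) * ((qy n ℓ h v T aW bL : ℕ) + 800 * (kq : ℤ) * T + (3 * (n * ℓ) / shearUnit n h + 1 : ℕ) + 1))
      + 3 * modulus n h v vβ * n ≤ 40 * (kq : ℤ) * 22 * modulus n h v vβ * n) ∧
    ((shearUnit n h : ℤ) * ((qy n ℓ h v T aW bL : ℕ) + 800 * (kq : ℤ) * T + (3 * (n * ℓ) / shearUnit n h + 1 : ℕ) + 1) + 2 * modulus n h v vβ ≤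
      40 * (kq : ℤ) * 2 * modulus n h v vβ) ∧
    ((shearUnit n h : ℤ) * (((qy n ℓ h v T aW bL : ℕ) : ℤ) + 800 * (kq : ℤ) * T + (3 * (n * ℓ) / shearUnit n h + 1 : ℕ) + 1) + 2 * modulus n h v vβ ≤
      40 * (kq : ℤ) * 5 * modulus n h v vβ) ∧
    ((shearUnit n h : ℤ) * ((800 * (kq : ℤ) - 1) * ((Qw n ℓ h : ℕ) : ℤ) + (qy n ℓ h v T aW bL : ℕ) + 800 * (kq : ℤ) * T + (3 * (n * ℓ) / shearUnit n h + 1 : ℕ) + 1) +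
      2 * modulus n h v vβ ≤ 40 * (kq : ℤ) * 22 * modulus n h v vβ) ∧
    ((P.r 0 : ℤ) * (modulus n h v vβ * (((Wmy n v : ℕ) : ℤ) + (Wpy n v : ℕ) + 800 * (kq : ℤ) * T + n) +
        |v| * ((shearUnit n h : ℤ) * ((2400 * (kq : ℤ) - 3 + ((qy n ℓ h v T aW bL : ℕ) : ℤ) + 800 * (kq : ℤ) * T + (3 * (n * ℓ) / shearUnit n h + 1 : ℕ)) + 1)) +
        |v| * (800 * (kq : ℤ) * (n + (shearUnit n h : ℤ)))) + 40 * (kq : ℤ) * modulus n h v vβ * n + (P.r 0 : ℤ) * n ≤ 40 * (kq : ℤ) * modulus n h v vβ * (n * (2 * (P.r 0 : ℤ)))) := by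
  obtain ⟨f1, f2, f3⟩ := U_floor (v := v) (vβ := vβ) hΔlo P2
  obtain ⟨uq, lq⟩ := UQ_le (v := v) (vβ := vβ) (ℓ := ℓ) hn hΔlo hΔhi
  have ula := ULa_le (v := v) (vβ := vβ) (ℓ := ℓ) (n := n) (h := h) hΔlo
  have uqy := Uqy_leK (vβ := vβ) hkq hn hvn hΔlo hΔhi P1 P2 P3 P4
  have hU : (0 : ℤ) ≤ (shearUnit n h : ℤ) := by positivity
  have hnU := n_le_U n h
  have hn1 : (1 : ℤ) ≤ n := by exact_mod_cast hn
  have hkq1 : (1 : ℤ) ≤ kq := by exact_mod_cast hkq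
  have hkq0 : (0 : ℤ) ≤ kq := by positivity
  have hΔ : (0 : ℤ) < modulus n h v vβ := by linarith
  have hn0 : (0 : ℤ) ≤ n := by positivity
  have hT0 : (0 : ℤ) ≤ T := by positivity
  have hv0 : (0 : ℤ) ≤ |v| := abs_nonneg v
  have hTn' : 2000 * T ≤ n := by omega
  have hTn : 2000 * (T : ℤ) ≤ n := by exact_mod_cast hTn'
  have hr0 : 40 * (kq : ℤ) ≤ P.r 0 := hr40 0
  have hW := Wmy_add_Wpy n v
  set U : ℤ := (shearUnit n h : ℤ) with hUdef
  set Δ : ℤ := modulus n h v vβ with hΔdef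
  set Q : ℤ := ((Qw n ℓ h : ℕ) : ℤ)
  set La : ℤ := ((3 * (n * ℓ) / shearUnit n h + 1 : ℕ) : ℤ)
  set qY : ℤ := ((qy n ℓ h v T aW bL : ℕ) : ℤ)
  set R : ℤ := (P.r 0 : ℤ)
  -- scaled product facts
  have hkΔ : Δ ≤ (kq : ℤ) * Δ := by have := mul_le_mul_of_nonneg_right hkq1 hΔ.le; linarith
  have hΔn : (0 : ℤ) ≤ Δ * n := by positivity
  have hkΔn : Δ * n ≤ (kq : ℤ) * (Δ * n) := by have := mul_le_mul_of_nonneg_right hkq1 hΔn; linarith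
  have e4 : (kq : ℤ) * (2000 * (T : ℤ) * U) ≤ (kq : ℤ) * Δ := mul_le_mul_of_nonneg_left f3 hkq0
  have e5 : (kq : ℤ) * (4000 * U) ≤ (kq : ℤ) * Δ := mul_le_mul_of_nonneg_left f2 hkq0
  have hΔT : Δ * (2000 * (T : ℤ)) ≤ Δ * n := mul_le_mul_of_nonneg_left hTn hΔ.le
  have hkΔT : (kq : ℤ) * (Δ * (2000 * (T : ℤ))) ≤ (kq : ℤ) * (Δ * n) := mul_le_mul_of_nonneg_left hΔT hkq0
  have hTU0 : (0 : ℤ) ≤ (T : ℤ) * U := by positivity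
  have hUX : U * (qY + 800 * (kq : ℤ) * T + La + 1) ≤ 6 * (kq : ℤ) * Δ := by linarith
  have hvX : |v| * (U * (qY + 800 * (kq : ℤ) * T + La + 1)) ≤ n * (6 * (kq : ℤ) * Δ) := mul_le_mul hvn hUX (by positivity) hn0
  have hk1 : (0 : ℤ) ≤ 800 * (kq : ℤ) - 1 := by linarith
  have h799 : (800 * (kq : ℤ) - 1) * (U * Q) ≤ (800 * (kq : ℤ) - 1) * (Δ + 2 * U) := mul_le_mul_of_nonneg_left uq hk1
  refine ⟨by linarith, by linarith, by linarith, by linarith, by linarith, ?_⟩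
  have hq0 : (0 : ℤ) ≤ qY := by positivity
  have hLa0 : (0 : ℤ) ≤ La := by positivity
  have hUY : U * ((2400 * (kq : ℤ) - 3 + qY + 800 * (kq : ℤ) * T + La) + 1) ≤ 6 * (kq : ℤ) * Δ := by linarith
  have hY0 : (0 : ℤ) ≤ U * ((2400 * (kq : ℤ) - 3 + qY + 800 * (kq : ℤ) * T + La) + 1) :=
    mul_nonneg hU (by nlinarith [hkq1, hq0, hLa0, hT0, hkq0])
  have hvY : |v| * (U * ((2400 * (kq : ℤ) - 3 + qY + 800 * (kq : ℤ) * T + La) + 1)) ≤ n * (6 * (kq : ℤ) * Δ) := mul_le_mul hvn hUY hY0 hn0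
  have h8 : 800 * (kq : ℤ) * (n + U) ≤ (kq : ℤ) * Δ := by
    have : 800 * (kq : ℤ) * (n + U) ≤ 800 * (kq : ℤ) * (U + U) := mul_le_mul_of_nonneg_left (by linarith) (by positivity)
    linarith
  have hv8 : |v| * (800 * (kq : ℤ) * (n + U)) ≤ n * ((kq : ℤ) * Δ) := mul_le_mul hvn h8 (by positivity) hn0
  have hΔv : Δ * |v| ≤ Δ * n := mul_le_mul_of_nonneg_left hvn hΔ.le
  have hin : Δ * (2 * n + |v| + 800 * (kq : ℤ) * T + n) + |v| * (U * ((2400 * (kq : ℤ) - 3 + qY + 800 * (kq : ℤ) * T + La) + 1)) +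
      |v| * (800 * (kq : ℤ) * (n + U)) ≤ 13 * ((kq : ℤ) * (Δ * n)) := by linarith
  rw [hW]
  have hR0 : (0 : ℤ) ≤ R := by linarith
  have k1 := mul_le_mul_of_nonneg_left hin hR0
  have k2 : 40 * (kq : ℤ) * (Δ * n) ≤ (Δ * n) * R := by have := mul_le_mul_of_nonneg_left hr0 hΔn; linarith
  have k2' : (Δ * n) * R ≤ (kq : ℤ) * ((Δ * n) * R) := by
    have := mul_le_mul_of_nonneg_right hkq1 (show (0 : ℤ) ≤ (Δ * n) * R by positivity); linarith
  have k3 : R * n ≤ (Δ * n) * R := by have := mul_le_mul_of_nonneg_left (show (1 : ℤ) ≤ Δ by linarith) (by positivity : (0 : ℤ) ≤ R * n); linarith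
  have k4 : (0 : ℤ) ≤ Δ * n * R := by positivity
  linarith

/-! ## §4 The floors of the targets -/

include hkq hn hvn hΔlo hΔhi P1 P2 in
/-- **The target floors `hxL1`, `hxL3`, `hyL1–3` in the (ζ′) scale** from (P1)–(P5) and `40kq ≤ r_i` — (P5) `r_i ≤ 4·b₀_i` is RULING B.16
(`b₀ := r/4`). [cite: KozmaNitzan2024, §4 Lemma 12 (pp. 23–25), p. 26 (M_v)] -/
theorem floors_targetK {P : PCells2} {b₀ : Fin 2 → ℕ} (hr40 : ∀ i, 40 * (kq : ℤ) ≤ (P.r i : ℤ)) (P3 : ((WA n aW : ℕ) : ℤ) ≤ 24 * (kq : ℤ) * n)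
    (P4 : (shearUnit n h : ℤ) * (((L0A bL : ℕ) : ℤ) + 1) ≤ 12 * (kq : ℤ) * modulus n h v vβ) (P5 : ∀ i, P.r i ≤ 4 * b₀ i) :
    (40 * (kq : ℤ) * modulus n h v vβ * n * (20 * (P.r 0 : ℤ) - (b₀ 0 : ℕ) + 1) + (P.r 0 : ℤ) * n +
      (P.r 0 : ℤ) * (|v| * ((shearUnit n h : ℤ) * ((qy n ℓ h v T aW bL : ℕ) + 800 * (kq : ℤ) * T + 1))) ≤ (P.r 0 : ℤ) * (modulus n h v vβ * ((800 * (kq : ℤ) - 1) * n - 800 * (kq : ℤ) * T))) ∧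
    ((P.r 1 : ℤ) * ((shearUnit n h : ℤ) * ((qy n ℓ h v T aW bL : ℕ) + 800 * (kq : ℤ) * T + 1)) + 40 * (kq : ℤ) * modulus n h v vβ ≤ 40 * (kq : ℤ) * modulus n h v vβ * (b₀ 1 : ℕ)) ∧
    (40 * (kq : ℤ) * modulus n h v vβ * (20 * (P.r 1 : ℤ) - (b₀ 1 : ℕ) + 1) + (P.r 1 : ℤ) * ((shearUnit n h : ℤ) - 1) <
      (P.r 1 : ℤ) * ((shearUnit n h : ℤ) * (800 * (kq : ℤ) * sA n ℓ h - (qy n ℓ h v T aW bL : ℕ) - 800 * (kq : ℤ) * T))) ∧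
    ((P.r 1 : ℤ) * ((shearUnit n h : ℤ) * (800 * (kq : ℤ) * ((Qw n ℓ h : ℕ) : ℤ) + (qy n ℓ h v T aW bL : ℕ) + 800 * (kq : ℤ) * T) + shearUnit n h - 1) <
      40 * (kq : ℤ) * modulus n h v vβ * (20 * (P.r 1 : ℤ) + (b₀ 1 : ℕ) - 1)) ∧
    ((P.r 0 : ℤ) * (modulus n h v vβ * (((Wmy n v : ℕ) : ℤ) + (Wpy n v : ℕ) + 800 * (kq : ℤ) * T) +
        |v| * ((shearUnit n h : ℤ) * ((2400 * (kq : ℤ) + ((qy n ℓ h v T aW bL : ℕ) : ℤ) + 800 * (kq : ℤ) * T) + 1)) + |v| * (800 * (kq : ℤ) * (n + (shearUnit n h : ℤ)))) +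
        40 * (kq : ℤ) * modulus n h v vβ * n + (P.r 0 : ℤ) * n ≤ 40 * (kq : ℤ) * modulus n h v vβ * (n * ((b₀ 0 : ℕ) : ℤ))) := by
  obtain ⟨f1, f2, f3⟩ := U_floor (v := v) (vβ := vβ) hΔlo P2
  obtain ⟨uq, lq⟩ := UQ_le (v := v) (vβ := vβ) (ℓ := ℓ) hn hΔlo hΔhi
  have usa := UsA_ge (v := v) (vβ := vβ) (ℓ := ℓ) hn hΔhi
  have uqy := Uqy_leK (vβ := vβ) hkq hn hvn hΔlo hΔhi P1 P2 P3 P4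
  have hU : (0 : ℤ) ≤ (shearUnit n h : ℤ) := by positivity
  have hnU := n_le_U n h
  have hn1 : (1 : ℤ) ≤ n := by exact_mod_cast hn
  have hkq1 : (1 : ℤ) ≤ kq := by exact_mod_cast hkq
  have hkq0 : (0 : ℤ) ≤ kq := by positivity
  have hΔ : (0 : ℤ) < modulus n h v vβ := by linarith
  have hn0 : (0 : ℤ) ≤ n := by positivity
  have hT0 : (0 : ℤ) ≤ T := by positivity
  have hv0 : (0 : ℤ) ≤ |v| := abs_nonneg v
  have hTn' : 2000 * T ≤ n := by omega
  have hTn : 2000 * (T : ℤ) ≤ n := by exact_mod_cast hTn'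
  have hr0 : 40 * (kq : ℤ) ≤ P.r 0 := hr40 0
  have hr1 : 40 * (kq : ℤ) ≤ P.r 1 := hr40 1
  have hb0 : (P.r 0 : ℤ) ≤ 4 * ((b₀ 0 : ℕ) : ℤ) := by exact_mod_cast P5 0
  have hb1 : (P.r 1 : ℤ) ≤ 4 * ((b₀ 1 : ℕ) : ℤ) := by exact_mod_cast P5 1
  have hW := Wmy_add_Wpy n v
  set U : ℤ := (shearUnit n h : ℤ) with hUdef
  set Δ : ℤ := modulus n h v vβ with hΔdef
  set Q : ℤ := ((Qw n ℓ h : ℕ) : ℤ)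
  set qY : ℤ := ((qy n ℓ h v T aW bL : ℕ) : ℤ)
  set R : ℤ := (P.r 0 : ℤ) with hR
  set S : ℤ := (P.r 1 : ℤ) with hS
  set B0 : ℤ := ((b₀ 0 : ℕ) : ℤ)
  set B1 : ℤ := ((b₀ 1 : ℕ) : ℤ)
  have hR0 : (0 : ℤ) ≤ R := by linarith
  have hS0 : (0 : ℤ) ≤ S := by linarith
  -- scaled product facts
  have hkΔ : Δ ≤ (kq : ℤ) * Δ := by have := mul_le_mul_of_nonneg_right hkq1 hΔ.le; linarith
  have hΔn : (0 : ℤ) ≤ Δ * n := by positivity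
  have hkΔn : Δ * n ≤ (kq : ℤ) * (Δ * n) := by have := mul_le_mul_of_nonneg_right hkq1 hΔn; linarith
  have e4 : (kq : ℤ) * (2000 * (T : ℤ) * U) ≤ (kq : ℤ) * Δ := mul_le_mul_of_nonneg_left f3 hkq0
  have e5 : (kq : ℤ) * (4000 * U) ≤ (kq : ℤ) * Δ := mul_le_mul_of_nonneg_left f2 hkq0
  have hΔT : Δ * (2000 * (T : ℤ)) ≤ Δ * n := mul_le_mul_of_nonneg_left hTn hΔ.le
  have hkΔT : (kq : ℤ) * (Δ * (2000 * (T : ℤ))) ≤ (kq : ℤ) * (Δ * n) := mul_le_mul_of_nonneg_left hΔT hkq0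
  have hTU0 : (0 : ℤ) ≤ (T : ℤ) * U := by positivity
  have hC1 : 2 * (U * (qY + 800 * (kq : ℤ) * T + 1)) ≤ 3 * ((kq : ℤ) * Δ) := by linarith
  have hC : 2 * (|v| * (U * (qY + 800 * (kq : ℤ) * T + 1))) ≤ 3 * ((kq : ℤ) * Δ * n) := by
    have h1 := mul_le_mul hvn (le_refl (U * (qY + 800 * (kq : ℤ) * T + 1))) (by positivity) hn0
    have h2 := mul_le_mul_of_nonneg_left hC1 hn0
    linarith
  have hΔ4 : (4000 : ℤ) ≤ Δ := by linarith
  -- facts about `R = r₀`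
  have kR3 : 40 * (kq : ℤ) * (Δ * n) ≤ (Δ * n) * R := by have := mul_le_mul_of_nonneg_left hr0 hΔn; linarith
  have kR3' : (Δ * n) * R ≤ (kq : ℤ) * ((Δ * n) * R) := by
    have := mul_le_mul_of_nonneg_right hkq1 (show (0 : ℤ) ≤ (Δ * n) * R by positivity); linarith
  have kR2 : 10 * ((kq : ℤ) * (Δ * n)) * R ≤ 40 * ((kq : ℤ) * (Δ * n)) * B0 := by
    have := mul_le_mul_of_nonneg_left hb0 (by positivity : (0 : ℤ) ≤ 10 * ((kq : ℤ) * (Δ * n))); linarith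
  have kR4 : 4000 * (R * n) ≤ (Δ * n) * R := by have := mul_le_mul_of_nonneg_left hΔ4 (by positivity : (0 : ℤ) ≤ R * n); linarith
  have kR5 : R * ((kq : ℤ) * (Δ * (2000 * (T : ℤ)))) ≤ R * ((kq : ℤ) * (Δ * n)) := mul_le_mul_of_nonneg_left hkΔT hR0
  have kR6 : (0 : ℤ) ≤ Δ * n * R := by positivity
  -- facts about `S = r₁`
  have kS6 : 40 * (kq : ℤ) * Δ ≤ Δ * S := by have := mul_le_mul_of_nonneg_left hr1 hΔ.le; linarith
  have kS6' : Δ * S ≤ (kq : ℤ) * (Δ * S) := by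
    have := mul_le_mul_of_nonneg_right hkq1 (show (0 : ℤ) ≤ Δ * S by positivity); linarith
  have kS5 : 10 * ((kq : ℤ) * Δ) * S ≤ 40 * ((kq : ℤ) * Δ) * B1 := by
    have := mul_le_mul_of_nonneg_left hb1 (by positivity : (0 : ℤ) ≤ 10 * ((kq : ℤ) * Δ)); linarith
  have hS1 : (0 : ℤ) < S := by linarith
  have kS7 : (0 : ℤ) < Δ * S := mul_pos hΔ hS1
  have kS2 : S * (U * qY) ≤ S * (Δ + 2 * U + 101 * (kq : ℤ) * (T : ℤ) * U) := mul_le_mul_of_nonneg_left uqy hS0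
  have kS3 : S * ((kq : ℤ) * (2000 * (T : ℤ) * U)) ≤ S * ((kq : ℤ) * Δ) := mul_le_mul_of_nonneg_left e4 hS0
  have kS4 : S * ((kq : ℤ) * (4000 * U)) ≤ S * ((kq : ℤ) * Δ) := mul_le_mul_of_nonneg_left e5 hS0
  have kS4b : S * (4000 * U) ≤ S * Δ := mul_le_mul_of_nonneg_left f2 hS0
  refine ⟨?_, ?_, ?_, ?_, ?_⟩
  · -- hxL1
    have k1 := mul_le_mul_of_nonneg_left hC hR0
    linarith [k1, kR2, kR3, kR3', kR4, kR5, kR6]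
  · -- hxL3
    have k1 : 2 * (S * (U * (qY + 800 * (kq : ℤ) * T + 1))) ≤ 3 * ((kq : ℤ) * Δ) * S := by have := mul_le_mul_of_nonneg_left hC1 hS0; linarith
    linarith [k1, kS5, kS6, kS6']
  · -- hyL1
    have hk8 : (0 : ℤ) ≤ 800 * (kq : ℤ) := by positivity
    have k1 : S * (800 * (kq : ℤ) * (Δ - 3 * U)) ≤ S * (800 * (kq : ℤ) * (U * sA n ℓ h)) :=
      mul_le_mul_of_nonneg_left (mul_le_mul_of_nonneg_left usa hk8) hS0
    linarith [k1, kS2, kS3, kS4, kS4b, kS5, kS6, kS6', kS7]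
  · -- hyL2
    have hk8 : (0 : ℤ) ≤ 800 * (kq : ℤ) := by positivity
    have k1 : S * (800 * (kq : ℤ) * (U * Q)) ≤ S * (800 * (kq : ℤ) * (Δ + 2 * U)) :=
      mul_le_mul_of_nonneg_left (mul_le_mul_of_nonneg_left uq hk8) hS0
    linarith [k1, kS2, kS3, kS4, kS4b, kS5, kS6, kS6', kS7]
  · -- hyL3
    rw [hW]
    have hUY : U * ((2400 * (kq : ℤ) + qY + 800 * (kq : ℤ) * T) + 1) ≤ 3 * ((kq : ℤ) * Δ) := by linarith
    have hvY : |v| * (U * ((2400 * (kq : ℤ) + qY + 800 * (kq : ℤ) * T) + 1)) ≤ n * (3 * ((kq : ℤ) * Δ)) := mul_le_mul hvn hUY (by positivity) hn0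
    have h8 : 5 * (800 * (kq : ℤ) * (n + U)) ≤ 2 * ((kq : ℤ) * Δ) := by
      have : 800 * (kq : ℤ) * (n + U) ≤ 800 * (kq : ℤ) * (U + U) := mul_le_mul_of_nonneg_left (by linarith) (by positivity)
      linarith
    have hv8 : 5 * (|v| * (800 * (kq : ℤ) * (n + U))) ≤ 2 * (n * ((kq : ℤ) * Δ)) := by
      have h1 := mul_le_mul hvn (le_refl (800 * (kq : ℤ) * (n + U))) (by positivity) hn0
      have h2 := mul_le_mul_of_nonneg_left h8 hn0
      linarith
    have hΔv : Δ * |v| ≤ Δ * n := mul_le_mul_of_nonneg_left hvn hΔ.le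
    have hin : 5 * (Δ * (2 * n + |v| + 800 * (kq : ℤ) * T) + |v| * (U * ((2400 * (kq : ℤ) + qY + 800 * (kq : ℤ) * T) + 1)) +
        |v| * (800 * (kq : ℤ) * (n + U))) ≤ 36 * ((kq : ℤ) * (Δ * n)) := by linarith
    have k1 := mul_le_mul_of_nonneg_left hin hR0
    linarith [k1, kR2, kR3, kR3', kR4, kR6]

end BandK

end CorrRec

end Skelφ

end Transplant

end Summit.CriticalPhenomena.PercolationContinuityZ3.Theorems

end
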